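import Summits.ResolutionOfSingularities.ResolutionOfSingularities.Theorems.FrobeniusLadderFInjectiveMacaulayficationCIFedderNecessity
import Summits.ResolutionOfSingularities.ResolutionOfSingularities.Theorems.FrobeniusLadderFInjectiveMacaulayficationCIFedderAtMaximalIdeal
import Summits.ResolutionOfSingularities.ResolutionOfSingularities.Theorems.FrobeniusLadderFInjectiveMacaulayficationQuotientOriginMaximal
import Summits.ResolutionOfSingularities.ResolutionOfSingularities.Theorems.FrobeniusLadderFInjectiveMacaulayficationWFixAtNonClosedDimTwo
import HarnessLib

/-!
# A complete intersection is NOT FULL at a closed point failing Fedder's test — chart and stalk forms (any embedding codimension,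
# every local equation allowed to be singular at the point)

Support file for crux stmt-ResolutionOfSingularities-15315 (`FrobeniusLadder.FInjectiveMacaulayfication`), chain w45a, seat res-L1-w45a-stub-2 g13
(res-L1-w45a-plan-1 RULING R23.11 (1)/(2): the INPUT and FLOOR NOT-FULL columns of the first non-hypersurface census row, BED CI-1).
[OURS · L1 W4.5a] — NOT a statement of the manuscript [claim: Hironaka2017]; AI-written, weaker than expert review. Nothing of the crux is proved.

This is the NEGATIVE twin of ✓ `CIFedderAtMaximalIdeal.ci_fedderAtMaximalIdeal(_of_certificate)` (which certifies FULL from `(∏ gs)^(p-1) ∉ (aᵢ^p)`), resting on the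
new necessity engine ✓ `CIFedderNecessity.not_clause_of_ringEquiv_of_ci_fedder_mem`. For `S = k[y₀, …, y_{n-1}]` (`char k = p`, `k` ANY field), an ideal
`I = (gs)` presented by a finite list, and a maximal ideal `Q` of `S ⧸ I` contracting to `P = (a₁, …, a_m)`:

* §1 `ci_not_clause_atMaximalIdeal` — if `(∏ gs)^(p-1) ∈ (a₁^p, …, a_m^p)` and `dim (S⧸I)_Q + |gs| = n` (expected dimension) then the local ring `(S ⧸ I)_Q` VIOLATES
  the per-stalk clause of the crux (some parameter ideal is not Frobenius closed): the engine in the regular local ring `S_P`, the test moved to `S` by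
  ✓ `FedderAtMaximalIdeal.algebraMap_pow_mem_frobeniusPower_maximalIdeal_iff`, transport along `S_P ⧸ (gs) ≅ (S⧸I)_Q` (✓ `CIFedderAtMaximalIdeal.nonempty_quotLocalizationEquiv`).
* §2 `ci_not_clause_atMaximalIdeal_of_certificate` — the dimension binder discharged by an s.o.p. certificate `hs ⊆ P`, `|gs| + |hs| = n`, `P^N ⊆ (gs ++ hs)`
  (✓ `CIFedderAtMaximalIdeal.ringKrullDim_stalk_add_length_of_sop_certificate`).
* §3 ★ `ci_not_fullCl_stalk_origin` — SCHEME VOCABULARY AT THE ORIGIN: for `F : Fin c → k[y]` vanishing at `0` with `(∏ F)^(p-1) ∈ (y₀^p, …, y_{n-1}^p)` and an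
  s.o.p. certificate `(y)^N ⊆ (F, hs)`, `c + |hs| = n`, the stalk of `X = Spec k[y]⧸(F)` at the origin `v` is NOT `FullCl p` — the CI twin of
  ✓ `HypersurfaceOriginNotFull.not_fullCl_stalk_origin_of_fedder_mem`. No primality or reducedness hypothesis on `(F)` is needed.

[cite: Fedder1983, Prop. 1.7, Thm. 1.12 and Prop. 2.1] No definitions, no named facts; glue over the engine.
-/

-- single-problem summit: the doubled namespace component is forced
set_option linter.dupNamespace false

noncomputable section

namespace Summit.ResolutionOfSingularities.ResolutionOfSingularities.Theorems.FInjectiveMacaulayfication.CINotFullAtMaximalIdeal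

open MvPolynomial IsLocalRing RingTheory.Sequence Literature.RingTheory.TightClosure Literature.AlgebraicGeometry.Resolution
  AlgebraicGeometry
open Summit.ResolutionOfSingularities.ResolutionOfSingularities.Theorems.FInjectiveMacaulayfication SliceableCentre

/-! ## §1 The chart form at a maximal ideal -/

section MaximalIdeal

variable (k : Type) [Field k] (n m : ℕ) (p : ℕ) [Fact p.Prime] [CharP k p]

set_option maxHeartbeats 400000 in
-- two localisations and a quotient are transported; the default budget is marginally too small
/-- **A COMPLETE INTERSECTION FAILING FEDDER'S TEST AT A CLOSED POINT VIOLATES THE CRUX'S CLAUSE THERE.** For a field `k` of characteristic `p`,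
`S = k[y₀, …, y_{n-1}]`, an ideal `I = (gs)` presented by a finite list, and a maximal ideal `Q` of `S ⧸ I` whose contraction to `S` is generated by
`a₁, …, a_m`: if `(∏ gs)^(p-1) ∈ (a₁^p, …, a_m^p)` and `dim (S⧸I)_Q + |gs| = n` (expected dimension), then the local ring `(S ⧸ I)_Q` does NOT satisfy
the per-stalk clause of `FrobeniusLadder.FInjectiveMacaulayfication` (some system of parameters generates an ideal that is not Frobenius closed).
[cite: Fedder1983, Thm. 1.12 and Prop. 2.1] -/
theorem ci_not_clause_atMaximalIdeal (a : Fin m → MvPolynomial (Fin n) k) (I : Ideal (MvPolynomial (Fin n) k))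
    (gs : List (MvPolynomial (Fin n) k)) (hI : I = Ideal.ofList gs)
    (Q : Ideal (MvPolynomial (Fin n) k ⧸ I)) [Q.IsMaximal]
    (hQ : Q.comap (Ideal.Quotient.mk I) = Ideal.span (Set.range a))
    (hfed : gs.prod ^ (p - 1) ∈ Ideal.span (Set.range fun i : Fin m => a i ^ p))
    (hdim : ringKrullDim (Localization.AtPrime Q) + (gs.length : WithBot ℕ∞) = (n : WithBot ℕ∞)) :
    ¬ (∀ d : ℕ, ringKrullDim (Localization.AtPrime Q) = d → ∀ s : Fin d → Localization.AtPrime Q,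
      (Ideal.span (Set.range s)).radical.IsMaximal →
        RingTheory.Sequence.IsWeaklyRegular (Localization.AtPrime Q) (List.ofFn s) ∧
        ∀ y : Localization.AtPrime Q, (∃ e : ℕ, y ^ p ^ e ∈ Ideal.span
          ((fun z : Localization.AtPrime Q => z ^ p ^ e) ''
            (Ideal.span (Set.range s) : Set (Localization.AtPrime Q)))) → y ∈ Ideal.span (Set.range s)) := by
  subst hI
  -- `P = Q ∩ S` is maximal; `R = S_P` is regular local of characteristic `p` and dimension `n`
  haveI hPmax : (Q.comap (Ideal.Quotient.mk (Ideal.ofList gs))).IsMaximal :=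
    Ideal.comap_isMaximal_of_surjective _ Ideal.Quotient.mk_surjective
  set P : Ideal (MvPolynomial (Fin n) k) := Q.comap (Ideal.Quotient.mk (Ideal.ofList gs)) with hP_def
  set R := Localization.AtPrime P
  haveI : IsRegularLocalRing R := IsRegularRing.isRegularLocalRing_localization P
  have hinj : Function.Injective (algebraMap (MvPolynomial (Fin n) k) R) :=
    IsLocalization.injective R P.primeCompl_le_nonZeroDivisors
  haveI : CharP R p := charP_of_injective_algebraMap hinj p
  have hdimR : ringKrullDim R = (n : WithBot ℕ∞) := by
    rw [IsLocalization.AtPrime.ringKrullDim_eq_height P R, MvPolynomial.height_eq_of_isMaximal k n P]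
    rfl
  -- the local equations upstairs
  set gs' : List R := gs.map (algebraMap (MvPolynomial (Fin n) k) R) with hgs'_def
  have hgsP : ∀ g ∈ gs, g ∈ P := by
    intro g hg
    rw [hP_def, Ideal.mem_comap,
      Ideal.Quotient.eq_zero_iff_mem.mpr (Ideal.subset_span (show g ∈ {r | r ∈ gs} from hg))]
    exact Q.zero_mem
  have hgs'm : ∀ g ∈ gs', g ∈ maximalIdeal R := by
    intro g hg
    obtain ⟨g₀, hg₀, rfl⟩ := List.mem_map.mp hg
    rw [← IsLocalization.AtPrime.map_eq_maximalIdeal P R]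
    exact Ideal.mem_map_of_mem _ (hgsP g₀ hg₀)
  -- Fedder's test FAILS upstairs
  have hfed' : gs'.prod ^ (p - 1) ∈ frobeniusPower p (maximalIdeal R) := by
    rw [hgs'_def, ← map_list_prod,
      FedderAtMaximalIdeal.algebraMap_pow_mem_frobeniusPower_maximalIdeal_iff k n m p P a hQ]
    exact hfed
  -- `R ⧸ (gs') ≅ (S ⧸ (gs))_Q`
  have hmap : Ideal.ofList gs' = (Ideal.ofList gs).map (algebraMap (MvPolynomial (Fin n) k) R) := by
    rw [hgs'_def, Ideal.map_ofList]
  obtain ⟨e₀⟩ := CIFedderAtMaximalIdeal.nonempty_quotLocalizationEquiv (MvPolynomial (Fin n) k) (Ideal.ofList gs) Q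
  have e₁ : (R ⧸ Ideal.ofList gs') ≃+* Localization.AtPrime Q := (Ideal.quotEquivOfEq hmap).trans e₀
  -- dimension bookkeeping upstairs
  have hdim' : ringKrullDim (R ⧸ Ideal.ofList gs') + (gs'.length : WithBot ℕ∞) = ringKrullDim R := by
    rw [ringKrullDim_eq_of_ringEquiv (R := R ⧸ Ideal.ofList gs') (S := Localization.AtPrime Q) e₁,
      hgs'_def, List.length_map, hdimR, hdim]
  exact CIFedderNecessity.not_clause_of_ringEquiv_of_ci_fedder_mem p R gs' hgs'm hdim' hfed' (T := Localization.AtPrime Q) e₁.symm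

/-! ## §2 The dimension binder from an s.o.p. certificate -/

/-- **CI NOT-FULL TEST AT A CLOSED POINT, CERTIFICATE FORM**: `(∏ gs)^(p-1) ∈ (a₁^p, …, a_m^p)` together with an s.o.p. certificate `hs ⊆ (aᵢ)`,
`|gs| + |hs| = n`, `(aᵢ)^N ⊆ (gs ++ hs)` ⇒ the local ring `(k[y] ⧸ I)_Q` (`I = (gs)`) at the closed point `Q` over `(aᵢ)` VIOLATES the per-stalk clause of
the crux. [cite: Fedder1983, Thm. 1.12 and Prop. 2.1] -/
theorem ci_not_clause_atMaximalIdeal_of_certificate (a : Fin m → MvPolynomial (Fin n) k) (I : Ideal (MvPolynomial (Fin n) k))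
    (gs hs : List (MvPolynomial (Fin n) k)) (hI : I = Ideal.ofList gs)
    (Q : Ideal (MvPolynomial (Fin n) k ⧸ I)) [Q.IsMaximal]
    (hQ : Q.comap (Ideal.Quotient.mk I) = Ideal.span (Set.range a))
    (hfed : gs.prod ^ (p - 1) ∈ Ideal.span (Set.range fun i : Fin m => a i ^ p))
    (hhs : ∀ h ∈ hs, h ∈ Ideal.span (Set.range a)) (hlen : gs.length + hs.length = n) (N : ℕ)
    (hN : Ideal.span (Set.range a) ^ N ≤ Ideal.ofList (gs ++ hs)) :
    ¬ (∀ d : ℕ, ringKrullDim (Localization.AtPrime Q) = d → ∀ s : Fin d → Localization.AtPrime Q,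
      (Ideal.span (Set.range s)).radical.IsMaximal →
        RingTheory.Sequence.IsWeaklyRegular (Localization.AtPrime Q) (List.ofFn s) ∧
        ∀ y : Localization.AtPrime Q, (∃ e : ℕ, y ^ p ^ e ∈ Ideal.span
          ((fun z : Localization.AtPrime Q => z ^ p ^ e) ''
            (Ideal.span (Set.range s) : Set (Localization.AtPrime Q)))) → y ∈ Ideal.span (Set.range s)) := by
  subst hI
  exact ci_not_clause_atMaximalIdeal k n m p a (Ideal.ofList gs) gs rfl Q hQ hfed
    (CIFedderAtMaximalIdeal.ringKrullDim_stalk_add_length_of_sop_certificate k n m a gs hs Q hQ hhs hlen N hN)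

end MaximalIdeal

/-! ## §3 ★ Scheme vocabulary: the origin of `Spec k[y] ⧸ (F)` -/

/-- The origin of `k[y]⧸(F)` pulls back to `(y₀, …, y_{n-1})` when the `F_l` vanish at `0`. [folklore] -/
-- adapted from `T4GermChar7.comap_origin_range` (the case `n = 5`)
theorem comap_origin_range (k : Type) [Field k] {n c : ℕ} (F : Fin c → MvPolynomial (Fin n) k) (hF : ∀ l, constantCoeff (F l) = 0) :
    (Ideal.span (Set.range fun j : Fin n => Ideal.Quotient.mk (Ideal.span (Set.range F)) (X j))).comap
        (Ideal.Quotient.mk (Ideal.span (Set.range F))) = Ideal.span (Set.range (X : Fin n → MvPolynomial (Fin n) k)) := by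
  rw [QuotientOriginMaximal.span_range_mk_X_eq_map, Ideal.comap_map_of_surjective _ Ideal.Quotient.mk_surjective, sup_eq_left,
    idealOfVars]
  intro q hq
  rw [Ideal.mem_comap, Ideal.mem_bot, Ideal.Quotient.eq_zero_iff_mem] at hq
  exact QuotientOriginMaximal.span_range_le_idealOfVars k F hF hq

/-- ★ **THE ORIGIN OF A COMPLETE INTERSECTION FAILING FEDDER'S TEST IS NOT A FULL POINT** (scheme vocabulary; the CI twin of
✓ `HypersurfaceOriginNotFull.not_fullCl_stalk_origin_of_fedder_mem`): `F : Fin c → k[y₀, …, y_{n-1}]` vanishing at the origin, `char k = p`, `k` ANY field;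
if `(∏ F)^(p-1) ∈ (y₀^p, …, y_{n-1}^p)` and `(F, hs)` is a system of parameters at the origin (`hs` vanishing at `0`, `c + |hs| = n`, `(y)^N ⊆ (F, hs)` — so
`V(F)` has the expected dimension `n − c` at `0`), then the stalk of `X = Spec k[y]⧸(F)` at the origin `v` is NOT `FullCl p`: some system of parameters of
`𝒪_{X,v}` generates an ideal that is not Frobenius closed. No primality, reducedness or isolatedness hypothesis. [cite: Fedder1983, Thm. 1.12 and Prop. 2.1] -/
theorem ci_not_fullCl_stalk_origin (p : ℕ) [Fact p.Prime] (k : Type) [Field k] [CharP k p] {n c : ℕ}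
    (F : Fin c → MvPolynomial (Fin n) k) (hF : ∀ l, constantCoeff (F l) = 0)
    (hfed : (∏ l, F l) ^ (p - 1) ∈ Ideal.span (Set.range fun i : Fin n => (X i : MvPolynomial (Fin n) k) ^ p))
    (hs : List (MvPolynomial (Fin n) k)) (hhs : ∀ h ∈ hs, constantCoeff h = 0) (hlen : c + hs.length = n) (N : ℕ)
    (hN : Ideal.span (Set.range (X : Fin n → MvPolynomial (Fin n) k)) ^ N ≤ Ideal.ofList (List.ofFn F ++ hs))
    (v : Spec (.of (MvPolynomial (Fin n) k ⧸ Ideal.span (Set.range F))))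
    (hv : v.asIdeal = Ideal.span (Set.range fun j : Fin n => Ideal.Quotient.mk (Ideal.span (Set.range F)) (X j))) :
    ¬ FullCl p ((Spec (.of (MvPolynomial (Fin n) k ⧸ Ideal.span (Set.range F)))).presheaf.stalk v) := by
  intro hfull
  -- the maximal ideal `P = (y₀, …, y_{n-1})` upstairs
  have hP : v.asIdeal.comap (Ideal.Quotient.mk (Ideal.span (Set.range F))) =
      Ideal.span (Set.range (X : Fin n → MvPolynomial (Fin n) k)) := by
    rw [hv, comap_origin_range k F hF]
  haveI hvmax : v.asIdeal.IsMaximal := by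
    rw [hv]
    exact QuotientOriginMaximal.isMaximal_span_range_mk_X k F hF
  -- `𝒪_{X,v} ≅ (k[y]/(F))_{(ȳ)}`
  letI : Algebra (MvPolynomial (Fin n) k ⧸ Ideal.span (Set.range F))
      ((Spec (.of (MvPolynomial (Fin n) k ⧸ Ideal.span (Set.range F)))).presheaf.stalk v) :=
    (StructureSheaf.toStalk (MvPolynomial (Fin n) k ⧸ Ideal.span (Set.range F)) v).hom.toAlgebra
  have hloc : IsLocalization.AtPrime ((Spec (.of (MvPolynomial (Fin n) k ⧸ Ideal.span (Set.range F)))).presheaf.stalk v) v.asIdeal :=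
    StructureSheaf.IsLocalization.to_stalk (MvPolynomial (Fin n) k ⧸ Ideal.span (Set.range F)) v
  have hfull' : FullCl p (Localization.AtPrime v.asIdeal) :=
    WFixAtNonClosedDimTwo.fullCl_of_ringEquiv p
      (IsLocalization.algEquiv v.asIdeal.primeCompl ((Spec (.of (MvPolynomial (Fin n) k ⧸ Ideal.span (Set.range F)))).presheaf.stalk v)
        (Localization.AtPrime v.asIdeal)).toRingEquiv hfull
  -- the list presentation and the certificate
  have hI : Ideal.span (Set.range F) = Ideal.ofList (List.ofFn F) := (FRationalModification.Exchange.ofList_ofFn F).symm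
  have hfed' : (List.ofFn F).prod ^ (p - 1) ∈ Ideal.span (Set.range fun i : Fin n => (X i : MvPolynomial (Fin n) k) ^ p) := by
    rw [List.prod_ofFn]; exact hfed
  have hhs' : ∀ h ∈ hs, h ∈ Ideal.span (Set.range (X : Fin n → MvPolynomial (Fin n) k)) := fun h hh =>
    (QuotientOriginMaximal.mem_idealOfVars_iff k h).mpr (hhs h hh)
  have hlen' : (List.ofFn F).length + hs.length = n := by rw [List.length_ofFn]; exact hlen
  exact ci_not_clause_atMaximalIdeal_of_certificate k n n p X (Ideal.span (Set.range F)) (List.ofFn F) hs hI v.asIdeal hP hfed'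
    hhs' hlen' N hN hfull'.2

end Summit.ResolutionOfSingularities.ResolutionOfSingularities.Theorems.FInjectiveMacaulayfication.CINotFullAtMaximalIdeal

end
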